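import Summits.BirchSwinnertonDyer.BirchSwinnertonDyer.Theorems.PrintCf2RamifiedOffTYZVisibleGenerator
import Summits.BirchSwinnertonDyer.BirchSwinnertonDyer.Theorems.PrintCf2RamifiedOffTYZLevelTwoModTwo
import Literature.NumberTheory.EllipticCurves.TianYuanZhang2017.CMPointCompositumDisplays
import Literature.NumberTheory.EllipticCurves.TianYuanZhang2017.GenusDescentTwist
import HarnessLib

/-!
# Route `PrintCf2`, crux stmt-BirchSwinnertonDyer-20509 `RamifiedOffTYZOfFacts` — THE LOWER HALF OF C⁺ ON VISIBLE SPECIAL GENERATORS OF THE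
# BLOCK-FREE FAMILY: `n ≡ 7 (mod 8)` square-free with no divisor `≡ 5 (mod 8)`, `ord_{s=1} L(E_n, s) = 1`, and a generator `h = (X, Y)` of
# `A_n(ℚ)` modulo torsion with `X ∉ ℚ^{×2} ∪ 2ℚ^{×2}` ⟹ `2 ∣ 𝓛(n)` — for EVERY number of prime factors and WITHOUT any Selmer hypothesis,
# conditional on the displays `tyz_cmPointCompositumData` and GZK
# (cell `bsd-print-cf2`, LEAD of 20509 g16, line `offtyz-v7`, lineage cycle 17; Theses-free, no `def`)

HONEST FRAMING (cell `bsd-print-cf2`, run/shared/lean/pub/bsd-print-cf2/; route `PrintCf2`; crux 20509 = `𝔅_ram → WAllCornerFTwoRamifiedOffTYZProved`,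
DECIDING, OPEN AS A CLASS): bookkeeping on PRINTED statements taken as hypotheses — the genus-point displays `GenusPointData.Printed` (Thm. 3.5,
Lemma 3.18), the CM-point layer with complex conjugation (`ConjSpec`) and the compositum sentence `CompositumSpec` ("`ℍ′_n := L_n(i)·∏_{d₀≡5,6} H′_{d₀}`",
TYZ §3.1 p0011 L60–L62), all delivered by the ONE named fact `tyz_cmPointCompositumData` (`TianYuanZhang2017/CMPointCompositumDisplays.lean`, typed by
this seat) — and Gross–Zagier–Kolyvagin by name (`rank_eq_analyticRank_of_analyticRank_le_one`).  Nothing about BSD is asserted; C⁺ =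
`stub_offTYZ_levelTwoScriptLExact` = item stmt-BirchSwinnertonDyer-23431 (on the jump-one class `2 ∥ 𝓛(n)`) stays OPEN.

THE RESULT.  `A_n : Y² = X³ + 4n²X` (`W2.Atwo n = (congruentNumberCurve n).twoIsogenyCodomain`), `Θ_A : A_n(ℚ) ⥲ A(K_n)⁻` the twist transfer of the
W2 kernel (`(X, Y) ↦ (−X/n, ·)`), `2^{ρ(n)} = [E_n(ℚ) : φ_n(A_n(ℚ)) + E_n[2]]` (TYZ §1).  For a generator `h = (X, Y)` of `A_n(ℚ)` modulo torsion the
`2`-isogeny descent class is `d(h) = [X] ∈ ℚ^×/ℚ^{×2}`; `d(h) = 1 ⟺ ρ(n) = 1`, so `ρ(n) = 0` (the SPECIAL stratum of the line, where the lower half of C⁺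
was open after g11–g15) is `d(h) ≠ 1`.  On the BLOCK-FREE family (`n ≡ 7 (mod 8)`, no divisor `≡ 5 (mod 8)`; equivalently every prime factor
`≡ 1, 7 (mod 8)` with an odd number `≡ 7`) the compositum sentence makes `ℍ′_n = L_n(i) = ℚ(i, √p : p ∣ n)`, whose Galois group is COMMUTATIVE
(`CompositumSpec.commute_of_noBlock`), and then (previous file `…VisibleGenerator`) the `K_n`-point `α = Θ_A(h) = (−X/n, ·)` is NOT `2`-divisible in
`A(ℍ′_n)` modulo torsion as soon as `(X/n)² + 4 ∉ ℚ² ∪ 2ℚ²`, i.e. **`X ∉ ℚ^{×2} ∪ 2ℚ^{×2}`** (`X·(X² + 4n²) = Y²`).  g2's door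
`LevelTwoModTwo.two_pow_dvd_of_isScriptL_of_generator_not_twoDivisible` (`[α_n] ≠ 0 ⟹ 2^{ρ+1} ∣ 𝓛(n)`) then gives:

* `two_dvd_scriptL_of_visible_of_displays` — square-free `n ≡ 7 (mod 8)` without divisors `≡ 5 (mod 8)`, `r_an(E_n) = 1`, GZK, data `D` with `Printed`
  and `CMPointCompositumPrinted`, `h = (X, Y) ∈ A_n(ℚ)` generating `A_n(ℚ)` modulo torsion with `X ∉ ℚ² ∪ 2ℚ²` ⟹ **`2 ∣ L` for every sign choice `L`
  of `𝓛(n)`**;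
* `two_dvd_scriptL_of_visible_of_facts` — the `OfFacts` shape **`(tyz_cmPointCompositumData ∧ GZK) → ∀ n …`** for the planner (a by-name closable
  aside text; no `thm11`, no `#Sel₂` hypothesis).

What this buys the line (LEAD census, crux 20509 / item 23431): with g11's `ρ(n) = 1` theorem (`d(h) = 1`, needs `s ≥ 2`) the LOWER half of C⁺ on the
block-free family now holds for every generator class EXCEPT `d(h) = 2` (`X ∈ 2ℚ^{×2}`), which is therefore the EXACT residual of the lower half there
(both parities of `s`; e.g. the k = 2 sector R2 = {lm : l ≡ 1, m ≡ 7 (mod 8)}: `Sel^{(φ)} = {1, 2, l, 2l}`, the theorem covers `d(h) ∈ {l, 2l}` — g15's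
explicit special members 791 = 7·113 (`X(h) = 113·4²`) and 943 = 23·41 are of this kind).  Converse reading (a falsifiable PREDICTION of the displays +
GZK, no BSD input): on this family `𝓛(n)` odd forces `X(h) ∈ ℚ² ∪ 2ℚ²` for the `A_n`-generator (`two_sq_or_sq_of_odd_scriptL`; e.g. `n = 7`:
`h = (2, 20)`).  Beyond print: YES (conditional on the displays).  BSD is not proved by any of this; no class is closed by this file.

References: [cite: TianYuanZhang2017, §1 (p0002 L101–L110: ρ(n), φ_n : A_n → E_n), §3.1 (p0011 L27–L36, L58–L66), Prop. 3.2 (3) (p0010 L112), Thm. 3.5 (p0011 L94–L100), Lemma 3.18 (p0017 L152–L153)];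
[cite: SilvermanAEC2009, Prop. X.1.4, X.4.9, X.5 Cor. 5.4]; [cite: Darmon2004, Thm. 3.22] (GZK); [cite: Lang2002, VI §1 Thm. 1.2, Cor. 1.4]; tree:
`…VisibleGenerator` (this seat), `…LevelTwoModTwo` (g2), `TianYuanZhang2017/GenusDescentTwist` (W2: `ΘA`), `…/CMPointCompositumDisplays` (this seat).
-/

noncomputable section

open scoped Classical

open WeierstrassCurve WeierstrassCurve.Affine WeierstrassCurve.Affine.Point
  Literature.NumberTheory.EllipticCurves Literature.NumberTheory.EllipticCurves.Rank1Residual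
  Literature.NumberTheory.EllipticCurves.TianYuanZhang2017
  Literature.NumberTheory.EllipticCurves.TianYuanZhang2017.W2
  Summit.BirchSwinnertonDyer.PrintCf2.VisibleGenerator

set_option autoImplicit false

namespace Summit.BirchSwinnertonDyer.PrintCf2.LowerHalfVisible

variable {n : ℕ}

/-! ## §1 From a generator `h = (X, Y)` of `A_n(ℚ)` to the `K_n`-point `α = Θ_A(h) = (−X/n, ·)` of `A` -/

/-- The affine equation of `A_n = (congruentNumberCurve n).twoIsogenyCodomain`: `Y² = X³ + 4n²X`. [cite: TianYuanZhang2017, §1 (p0002 L101–L110)] -/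
theorem Atwo_equation {X Y : ℚ} (h : (Atwo n).toAffine.Nonsingular X Y) : Y ^ 2 = X ^ 3 + 4 * (n : ℚ) ^ 2 * X := by
  have he := (Affine.equation_iff _ _).mp h.left
  rw [Atwo_a₂, Atwo_a₄] at he
  simp [twoIsogenyCodomain, congruentNumberCurve] at he
  linear_combination he

/-- **`Θ_A(h)` generates the free part of `A(K_n)⁻` when `h` generates `A_n(ℚ)` modulo torsion** (`Θ_A` is an isomorphism onto the minus part:
`map_conj_ΘA`, `exists_ΘA_eq`, additivity). [cite: TianYuanZhang2017, §3.1 (p0011 L29–L36)] [cite: SilvermanAEC2009, X.5 Cor. 5.4] -/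
theorem generatesFreePart_ΘA (hn : n ≠ 0) (h₀ : (Atwo n).toAffine.Point)
    (hgen : ∀ P : (Atwo n).toAffine.Point, ∃ m : ℤ, IsOfFinAddOrder (P - m • h₀)) :
    GeneratesFreePart n (ΘA hn h₀) := by
  refine ⟨map_conj_ΘA hn h₀, fun γ hγ => ?_⟩
  obtain ⟨P, rfl⟩ := exists_ΘA_eq hn γ hγ
  obtain ⟨m, hm⟩ := hgen P
  refine ⟨m, ?_⟩
  have e : ΘA hn P - m • ΘA hn h₀ = ΘA hn (P - m • h₀) := by rw [map_sub, map_zsmul]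
  rw [e]
  exact (ΘA hn).isOfFinAddOrder hm

/-- **The image of `α = Θ_A(X, Y)` in `A(ℍ′_n)` is a point `(−X/n, ·)` with RATIONAL abscissa** (`Θ_A(X,Y) = (X/θ², Y/θ³)`, `θ² = −n`, and
`K_n → ℍ′_n` sends `θ ↦ √−n`). [cite: TianYuanZhang2017, §3.1 (p0011 L27–L36, L60–L64)] [cite: SilvermanAEC2009, X.5 Cor. 5.4] -/
theorem exists_map_ΘA_eq_some (hsq : Squarefree n) (D : GenusPointData n) {X Y : ℚ} (h : (Atwo n).toAffine.Nonsingular X Y) :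
    ∃ (Y' : D.H) (hP : (curveA.baseChange D.H).toAffine.Nonsingular (algebraMap ℚ D.H (-X / n)) Y'),
      Point.map (W' := curveA) (D.embK n (Nat.mem_divisors_self n hsq.ne_zero)) (ΘA hsq.ne_zero (.some X Y h)) =
        Point.some _ _ hP := by
  have hn0 : n ≠ 0 := hsq.ne_zero
  have hn : n ∈ n.divisors := Nat.mem_divisors_self n hn0
  have hnH : (n : D.H) ≠ 0 := by exact_mod_cast hn0
  obtain ⟨h₁, e₁⟩ := ΘA_some hn0 h
  set x₁ : GenusField n := (θn n ^ 2)⁻¹ * algebraMap ℚ (GenusField n) X with hx₁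
  set y₁ : GenusField n := (θn n ^ 3)⁻¹ * algebraMap ℚ (GenusField n) Y with hy₁
  have hθ : D.embK n hn (θn n) = D.sqrtNeg n := AdjoinRoot.liftAlgHom_root _ _ _ _
  have hs : D.sqrtNeg n ^ 2 = -(n : D.H) := D.sqrtNeg_sq n hn
  have hx : D.embK n hn x₁ = algebraMap ℚ D.H (-X / n) := by
    rw [hx₁, map_mul, map_inv₀, map_pow, hθ, hs, AlgHom.commutes, map_div₀, map_neg, map_natCast]
    field_simp
  have hy : (D.embK n hn y₁) ^ 2 = (algebraMap ℚ D.H (-X / n)) ^ 3 + 4 * algebraMap ℚ D.H (-X / n) := by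
    have e := (curveA_nonsingular_iff _ _).mp h₁
    have e' : D.embK n hn (y₁ ^ 2) = D.embK n hn (x₁ ^ 3 + 4 * x₁) := by rw [e]
    have h4 : D.embK n hn (4 * x₁) = 4 * D.embK n hn x₁ := by rw [map_mul, map_ofNat]
    rw [map_pow, map_add, map_pow, h4, hx] at e'
    exact e'
  refine ⟨D.embK n hn y₁, (curveA_nonsingular_iff _ _).mpr hy, ?_⟩
  rw [e₁, Point.map_some]
  simp only [Point.some.injEq]
  exact ⟨hx, rfl⟩

/-- **Visibility transfers from `h` to `α`**: if `X ∉ ℚ^{×2} ∪ 2ℚ^{×2}` for `h = (X, Y) ∈ A_n(ℚ)`, then `(−X/n)² + 4 ∉ ℚ² ∪ 2ℚ²`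
(`X·((X/n)² + 4)·n² = X(X² + 4n²) = Y²`). [cite: TianYuanZhang2017, §1 (p0002 L101–L110)] [cite: SilvermanAEC2009, Prop. X.4.9] -/
theorem not_sq_add_four_of_not_sq (hn : n ≠ 0) {X Y : ℚ} (h : (Atwo n).toAffine.Nonsingular X Y)
    (hX : ¬ ∃ q : ℚ, X = q ^ 2 ∨ X = 2 * q ^ 2) :
    ¬ ∃ q : ℚ, (-X / n) ^ 2 + 4 = q ^ 2 ∨ (-X / n) ^ 2 + 4 = 2 * q ^ 2 := by
  have hnQ : (n : ℚ) ≠ 0 := by exact_mod_cast hn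
  have heq := Atwo_equation h
  have hX0 : X ≠ 0 := by rintro rfl; exact hX ⟨0, Or.inl (by ring)⟩
  rintro ⟨q, hq | hq⟩
  · -- `X² + 4n² = (nq)²`, so `X = (Y/(nq))²`
    have hq0 : q ≠ 0 := by
      rintro rfl
      have : (-X / n) ^ 2 + 4 = 0 := by simpa using hq
      nlinarith [sq_nonneg (-X / n)]
    have h1 : X ^ 2 + 4 * (n : ℚ) ^ 2 = (n * q) ^ 2 := by
      field_simp at hq; linear_combination hq
    refine hX ⟨Y / (n * q), Or.inl ?_⟩
    have hnq : ((n : ℚ) * q) ^ 2 ≠ 0 := pow_ne_zero 2 (mul_ne_zero hnQ hq0)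
    have key : X * ((n : ℚ) * q) ^ 2 = Y ^ 2 := by rw [← h1]; linear_combination -heq
    calc X = X * ((n : ℚ) * q) ^ 2 / ((n : ℚ) * q) ^ 2 := (mul_div_cancel_right₀ X hnq).symm
      _ = Y ^ 2 / ((n : ℚ) * q) ^ 2 := by rw [key]
      _ = (Y / (n * q)) ^ 2 := by rw [div_pow]
  · -- `X² + 4n² = 2(nq)²`, so `X = 2·(Y/(2nq))²`
    have hq0 : q ≠ 0 := by
      rintro rfl
      have : (-X / n) ^ 2 + 4 = 0 := by simpa using hq
      nlinarith [sq_nonneg (-X / n)]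
    have h1 : X ^ 2 + 4 * (n : ℚ) ^ 2 = 2 * (n * q) ^ 2 := by
      field_simp at hq; linear_combination hq
    refine hX ⟨Y / (2 * n * q), Or.inr ?_⟩
    have hnq : ((2 : ℚ) * n * q) ^ 2 ≠ 0 := pow_ne_zero 2 (mul_ne_zero (mul_ne_zero two_ne_zero hnQ) hq0)
    have key : X * ((2 : ℚ) * n * q) ^ 2 = 2 * Y ^ 2 := by linear_combination (-2 * X) * h1 - 2 * heq
    calc X = X * ((2 : ℚ) * n * q) ^ 2 / ((2 : ℚ) * n * q) ^ 2 := (mul_div_cancel_right₀ X hnq).symm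
      _ = 2 * Y ^ 2 / ((2 : ℚ) * n * q) ^ 2 := by rw [key]
      _ = 2 * (Y / (2 * n * q)) ^ 2 := by rw [div_pow]; ring

/-! ## §2 The lower half on visible special generators of the block-free family -/

/-- For odd `n`, a divisor is never `≡ 6 (mod 8)`; with the hypothesis «no divisor `≡ 5 (mod 8)`» the family has NO block. [folklore] -/
private theorem noBlock_of_odd (hodd : Odd n) (hnb : ∀ d ∈ n.divisors, d % 8 ≠ 5) :
    ∀ d ∈ n.divisors, d % 8 ≠ 5 ∧ d % 8 ≠ 6 := by
  intro d hd
  refine ⟨hnb d hd, fun h6 => ?_⟩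
  have hdvd : d ∣ n := Nat.dvd_of_mem_divisors hd
  have hd_odd : Odd d := hodd.of_dvd_nat hdvd
  obtain ⟨k, hk⟩ := hd_odd
  omega

/-- **THE LOWER HALF OF C⁺ ON VISIBLE SPECIAL GENERATORS (display form).**  Square-free `n ≡ 7 (mod 8)` WITHOUT divisors `≡ 5 (mod 8)` (block-free:
`ℍ′_n = L_n(i)`); `ord_{s=1} L(E_n, s) = 1`; GZK; data `D : GenusPointData n` with the displays `Printed` (Thm. 3.5, Lemma 3.18) and
`CMPointCompositumPrinted` (complex conjugation + the compositum sentence); `h = (X, Y) ∈ A_n(ℚ)` generating `A_n(ℚ)` modulo torsion with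
**`X ∉ ℚ^{×2} ∪ 2ℚ^{×2}`** (descent class `d(h) ∉ {1, 2}`; in particular `ρ(n) = 0`).  Then **`2 ∣ L` for every integer `L` with `𝓛(n)² = L²`** —
NO Selmer hypothesis, every number of prime factors.  (Chain: `α = Θ_A(h)` generates the free part of `A(K_n)⁻`; its abscissa is `−X/n ∈ ℚ` with
`(X/n)² + 4 ∉ ℚ² ∪ 2ℚ²`; `Gal(ℍ′_n/ℚ)` is commutative by the compositum sentence; `…VisibleGenerator.not_twoDivisible_of_sq_add_four` gives
`[α_n] ≠ 0`; g2's `two_pow_dvd_of_isScriptL_of_generator_not_twoDivisible` gives `2^{ρ+1} ∣ L`.)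
[cite: TianYuanZhang2017, §1 (p0002 L101–L110), §3.1 (p0011 L27–L36, L58–L66), Prop. 3.2 (3) (p0010 L112), Thm. 3.5 (p0011 L94–L100), Lemma 3.18 (p0017 L152–L153)]
[cite: SilvermanAEC2009, Prop. X.1.4, X.5 Cor. 5.4] [cite: Darmon2004, Thm. 3.22] [cite: Lang2002, VI §1 Thm. 1.2, Cor. 1.4] -/
theorem two_dvd_scriptL_of_visible_of_displays (hGZK : rank_eq_analyticRank_of_analyticRank_le_one) (hsq : Squarefree n) (h7 : n % 8 = 7)
    (hnb : ∀ d ∈ n.divisors, d % 8 ≠ 5)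
    (hr : haveI := isElliptic_congruentNumberCurve hsq.ne_zero; (congruentNumberCurve n).analyticRank = 1)
    (D : GenusPointData n) (hPr : D.Printed) (hC : D.CMPointCompositumPrinted)
    {X Y : ℚ} (h : (Atwo n).toAffine.Nonsingular X Y)
    (hgen : ∀ P : (Atwo n).toAffine.Point, ∃ m : ℤ, IsOfFinAddOrder (P - m • (Point.some X Y h : (Atwo n).toAffine.Point)))
    (hX : ¬ ∃ q : ℚ, X = q ^ 2 ∨ X = 2 * q ^ 2) {L : ℤ} (hL : IsScriptL n L) : (2 : ℤ) ∣ L := by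
  haveI := isElliptic_congruentNumberCurve hsq.ne_zero
  have hn0 : n ≠ 0 := hsq.ne_zero
  have hodd : Odd n := Nat.odd_iff.mpr (by omega)
  -- the displays
  have h35 : D.thm35Main := hPr.2.2.2.2.1
  have hLs : D.scriptLSpec := hPr.1
  have h318 : D.lemma318 := hPr.2.2.2.2.2.2.2.2.1
  obtain ⟨z, Φ, ΓH, ΓH', σ, θ, c, ρ₂, ρ₄, hconj, -, hcomp⟩ := hC
  have hcomm : ∀ g : D.H ≃ₐ[ℚ] D.H, g * c = c * g := fun g => hcomp.commute_of_noBlock (noBlock_of_odd hodd hnb) g c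
  -- the generator `α = Θ_A(h)` and its image in `A(ℍ′_n)`
  have hα : GeneratesFreePart n (ΘA hn0 (Point.some X Y h)) := generatesFreePart_ΘA hn0 _ hgen
  obtain ⟨Y', hP, hmap⟩ := exists_map_ΘA_eq_some hsq D h
  have hα2 : ¬ ∃ y : APoint D.H, IsOfFinAddOrder
      (Point.map (W' := curveA) (D.embK n (Nat.mem_divisors_self n hsq.ne_zero)) (ΘA hn0 (Point.some X Y h)) - (2 : ℤ) • y) := by
    rw [hmap]
    exact not_twoDivisible_of_sq_add_four D hodd h318 c hconj.1 hconj.2.2 hcomm hP (not_sq_add_four_of_not_sq hn0 h hX)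
  -- `2^ρ` = the index, and g2's door
  obtain ⟨ρ, hρ⟩ := stub_S3 hsq
  have h2 := LevelTwoModTwo.two_pow_dvd_of_isScriptL_of_generator_not_twoDivisible hGZK hsq (Or.inr (Or.inr h7)) hr D h35 hLs hρ hα hα2 hL
  exact (dvd_pow_self (2 : ℤ) (Nat.succ_ne_zero ρ)).trans h2

/-! ## §3 The `OfFacts` shapes for the planner -/

/-- **THE LOWER HALF ON VISIBLE SPECIAL GENERATORS, GRANTED THE NAMED FACTS** `tyz_cmPointCompositumData` (TYZ §3 displays incl. the compositum
sentence) and GZK. [cite: TianYuanZhang2017, §1, §3.1 (p0011 L58–L66), Thm. 3.5, Lemma 3.18] [cite: Darmon2004, Thm. 3.22] -/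
theorem two_dvd_scriptL_of_visible_of_facts' (hF : tyz_cmPointCompositumData) (hGZK : rank_eq_analyticRank_of_analyticRank_le_one)
    (hsq : Squarefree n) (h7 : n % 8 = 7) (hnb : ∀ d ∈ n.divisors, d % 8 ≠ 5)
    (hr : haveI := isElliptic_congruentNumberCurve hsq.ne_zero; (congruentNumberCurve n).analyticRank = 1)
    {X Y : ℚ} (h : (Atwo n).toAffine.Nonsingular X Y)
    (hgen : ∀ P : (Atwo n).toAffine.Point, ∃ m : ℤ, IsOfFinAddOrder (P - m • (Point.some X Y h : (Atwo n).toAffine.Point)))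
    (hX : ¬ ∃ q : ℚ, X = q ^ 2 ∨ X = 2 * q ^ 2) : ∀ L : ℤ, IsScriptL n L → (2 : ℤ) ∣ L := by
  obtain ⟨D, hPr, hC⟩ := hF n hsq (Or.inr (Or.inr h7))
  exact fun L hL => two_dvd_scriptL_of_visible_of_displays hGZK hsq h7 hnb hr D hPr hC h hgen hX hL

/-- **`OfFacts` shape for the planner** (a by-name closable aside text: the lower half of C⁺ on the special generators `d(h) ∉ {1, 2}` of the block-free
family `n ≡ 7 (mod 8)`, no divisor `≡ 5 (mod 8)`; no `thm11`, no `#Sel₂` hypothesis; `A_n = (congruentNumberCurve n).twoIsogenyCodomain`).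
[cite: TianYuanZhang2017, §1, §3.1 (p0011 L58–L66), Thm. 3.5, Lemma 3.18] [cite: Darmon2004, Thm. 3.22] -/
theorem two_dvd_scriptL_of_visible_of_facts :
    (tyz_cmPointCompositumData ∧ rank_eq_analyticRank_of_analyticRank_le_one) →
      ∀ n : ℕ, (hsq : Squarefree n) → n % 8 = 7 → (∀ d ∈ n.divisors, d % 8 ≠ 5) →
        (haveI := isElliptic_congruentNumberCurve hsq.ne_zero; (congruentNumberCurve n).analyticRank = 1) →
        ∀ (X Y : ℚ) (h : ((congruentNumberCurve n).twoIsogenyCodomain).toAffine.Nonsingular X Y),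
          (∀ P, ∃ m : ℤ, IsOfFinAddOrder
              (P - m • (Point.some X Y h : ((congruentNumberCurve n).twoIsogenyCodomain).toAffine.Point))) →
          (¬ ∃ q : ℚ, X = q ^ 2 ∨ X = 2 * q ^ 2) →
            ∀ L : ℤ, IsScriptL n L → (2 : ℤ) ∣ L :=
  fun hFG _ hsq h7 hnb hr _ _ h hgen hX => two_dvd_scriptL_of_visible_of_facts' hFG.1 hFG.2 hsq h7 hnb hr h hgen hX

/-! ## §4 The converse reading: on the block-free family an ODD `𝓛(n)` forces `X(h) ∈ ℚ² ∪ 2ℚ²` (a falsifiable prediction of the displays + GZK) -/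

/-- **`𝓛(n)` odd ⟹ the `A_n`-generator has `X ∈ ℚ^{×2} ∪ 2ℚ^{×2}`** on the block-free family (contrapositive of §2; e.g. `n = 7`: `h = (2, 20)`,
`X = 2`).  On TYZ's `𝓛`-odd families this is consistent with Selmer minimality (`Sel^{(φ)}(A_n) = {1, 2}`); stated here as the honest converse.
[cite: TianYuanZhang2017, Thm. 1.1, §3.1 (p0011 L58–L66), Thm. 3.5] [cite: Darmon2004, Thm. 3.22] -/
theorem sq_or_two_sq_of_odd_scriptL (hF : tyz_cmPointCompositumData) (hGZK : rank_eq_analyticRank_of_analyticRank_le_one)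
    (hsq : Squarefree n) (h7 : n % 8 = 7) (hnb : ∀ d ∈ n.divisors, d % 8 ≠ 5)
    (hr : haveI := isElliptic_congruentNumberCurve hsq.ne_zero; (congruentNumberCurve n).analyticRank = 1)
    {X Y : ℚ} (h : (Atwo n).toAffine.Nonsingular X Y)
    (hgen : ∀ P : (Atwo n).toAffine.Point, ∃ m : ℤ, IsOfFinAddOrder (P - m • (Point.some X Y h : (Atwo n).toAffine.Point)))
    {L : ℤ} (hL : IsScriptL n L) (hodd : Odd L) : ∃ q : ℚ, X = q ^ 2 ∨ X = 2 * q ^ 2 := by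
  by_contra hX
  exact (Int.not_even_iff_odd.mpr hodd) (even_iff_two_dvd.mpr (two_dvd_scriptL_of_visible_of_facts' hF hGZK hsq h7 hnb hr h hgen hX L hL))

end Summit.BirchSwinnertonDyer.PrintCf2.LowerHalfVisible

end
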